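import Literature.Combinatorics.LorentzianPolynomials.Quadratic
import Literature.Topology.FourManifolds.LatticeFormsOrthoSumSignature
import HarnessLib

/-!
# Lorentzian polynomials under nonnegative diagonal scaling `w_i ↦ c_i w_i` and under injective renaming of the
# variables (Brändén–Huh 2020, Theorem 2.10: the dilation case `(II)`, permutations, dummy variables)

Layer `Literature/Combinatorics/LorentzianPolynomials`, namespace `Literature.Combinatorics.LorentzianPolynomials`;
lane `lit-hodgefound` (Track 2 foundations library), seat p16, generation 27 (row g27-#8). Sequel of `Quadratic.lean` (row
g27-#7: Theorem 2.25 as a criterion for Definition 2.6, `mem_lorentzian_iff_forall_sigPos_normCoeff`: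
`f ∈ L^{m+2}_n ⟺ f ∈ M^{m+2}_n ∧ ∀ α ∈ Δ^m_n, sigPos (c_{α+e_a+e_b}(f))_{a,b} ≤ 1`) and of the tree's
`LinearMap.BilinForm.sigPos_le_sigPos_of_comp` (the positive index of inertia does not increase under pull-back).

## Source (verbatim) — P. Brändén, J. Huh, *Lorentzian polynomials* [BrandenHuh2019] (held `paper:arxiv-1902.03719`)

* §2.2 **Theorem 2.10**: "If `f(w) ∈ L^d_n`, then `f(Av) ∈ L^d_m` for any `n × m` matrix `A` with nonnegative entries."
  Proof: "Theorem 2.10 follows from its three special cases: (I) the elementary splitting `f(w_1, …, w_{n-1}, w_n + w_{n+1})`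
  is in `L^d_{n+1}`, (II) the dilation `f(w_1, …, w_{n-1}, θ w_n)` is in `L^d_n` for any `θ ≥ 0`, (III) the diagonalization
  `f(w_1, …, w_{n-2}, w_{n-1}, w_{n-1})` is in `L^d_{n-1}` […] For the second statement, note from the definition of
  M-convexity that `f(w_1, …, w_{n-1}, 0) ∈ M^d_n`. Thus the second statement for `θ = 0` follows from the case `θ > 0`,
  which is trivial to verify."
* §4.1 proof of Prop. 4.4: "Substituting `w_k` by zero for all `k` other than `i` and `j`, we get the bivariate quadratic
  polynomial […]".
* §2.2 (p. 11): M-convex sets (exchange property); Definition 2.6; §2.4 Theorem 2.25.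

## What is here (`σ`, `τ` finite index types; `c : σ → ℝ` with `c ≥ 0`; `ι : σ → τ` injective)

* §1 M-convex sets: **`IsMConvex.sep_apply_eq_zero`** (cutting by a coordinate face `{α : α_i = 0 for i ∈ Z}` keeps M-convexity —
  "note from the definition of M-convexity that `f(w_1, …, w_{n-1}, 0) ∈ M^d_n`"), **`IsMConvex.image_mapDomain`**
  (transport along an injective relabeling).
* §2 (private plumbing) `sigPos_toBilin'_zero` (the zero form has no positive eigenvalue) and the pull-back step
  `sigPos_toBilin'_le_of_eq`.
* §3 **`diagScale c f = f(c_1 w_1, …, c_n w_n)`** (def by coefficients `coeff_α = c^α coeff_α(f)`; `eval_diagScale`),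
  `normCoeff_diagScale`, `isHomogeneous_diagScale`, `support_diagScale`, and **`diagScale_mem_lorentzian`**: `f ∈ L^d_n`,
  `c ≥ 0 ⟹ f(c_1 w_1, …, c_n w_n) ∈ L^d_n` — all dilations (II) at once, `θ = 0` included (killing variables); the matrices
  `(c^{α+e_a+e_b} c_{α+e_a+e_b}(f))_{ab}` are the pull-backs of `(c_{α+e_a+e_b}(f))_{ab}` along `x ↦ √(c^α)·(c_a x_a)_a`.
* §4 `normCoeff_rename_mapDomain`, `coeff_rename_eq_zero_of_not_mem_range`, and **`rename_mem_lorentzian`**: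
  `f ∈ L^d_σ ⟹ rename ι f ∈ L^d_τ` for injective `ι` (Theorem 2.10 for the `0/1` matrix of `ι`: permutations of the
  variables and adjoining variables on which `f` does not depend).

One definition with body (`diagScale`), theorems otherwise; no `sorry`, no named fact (net debt 0). TODO(general form):
Theorem 2.10 for an arbitrary nonnegative matrix `A` (cases (I) splitting and (III) diagonalization need §2.3).

## References

* [BrandenHuh2019] P. Brändén, J. Huh, *Lorentzian polynomials*, Ann. of Math. (2) 192 (2020) 821–891, arXiv:1902.03719 —
  §2.2 Thm. 2.10 and its proof (cases (I)–(III)), Def. 2.6, p. 11 (M-convex sets); §2.4 Thm. 2.25; §4.1 proof of Prop. 4.4.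
-/

noncomputable section

open MvPolynomial Finsupp Finset
open scoped Nat

namespace Literature.Combinatorics.LorentzianPolynomials

variable {σ τ : Type*}

/-! ## §1 M-convex sets: coordinate faces and injective relabelings -/

section MConvexOps

/-- **A coordinate face of an M-convex set is M-convex**: `{α ∈ J : α_i = 0 for all i ∈ Z}` has the exchange property
(the partner `j` has `β_j > α_j ≥ 0`, so `j ∉ Z`). Brändén–Huh: "note from the definition of M-convexity that
`f(w_1, …, w_{n-1}, 0) ∈ M^d_n`". [cite: BrandenHuh2019, §2.2 proof of Thm. 2.10 (case (II), `θ = 0`)] -/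
theorem IsMConvex.sep_apply_eq_zero {J : Set (σ →₀ ℕ)} (hJ : IsMConvex J) (Z : Set σ) :
    IsMConvex {α | α ∈ J ∧ ∀ i ∈ Z, α i = 0} := by
  classical
  rintro α β ⟨hα, hαZ⟩ ⟨hβ, hβZ⟩ i hi
  obtain ⟨j, hj, hmem⟩ := hJ hα hβ i hi
  refine ⟨j, hj, hmem, fun k hk ↦ ?_⟩
  have hjk : j ≠ k := by rintro rfl; have := hβZ j hk; omega
  rw [Finsupp.add_apply, Finsupp.tsub_apply, Finsupp.single_apply, Finsupp.single_apply, if_neg hjk, hαZ k hk]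
  simp

/-- `mapDomain ι (α - e_i + e_j) = mapDomain ι α - e_{ι i} + e_{ι j}` for injective `ι` and `α_i ≠ 0`.
[cite: BrandenHuh2019, §2.2 (p. 11, "`α - e_i + e_j`")] -/
theorem mapDomain_sub_single_add_single (ι : σ → τ) {α : σ →₀ ℕ} {i : σ} (hi : α i ≠ 0) (j : σ) :
    Finsupp.mapDomain ι (α - Finsupp.single i 1 + Finsupp.single j 1) =
      Finsupp.mapDomain ι α - Finsupp.single (ι i) 1 + Finsupp.single (ι j) 1 := by
  have h : Finsupp.mapDomain ι (α - Finsupp.single i 1) + Finsupp.single (ι i) 1 = Finsupp.mapDomain ι α := by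
    rw [← Finsupp.mapDomain_single (f := ι), ← Finsupp.mapDomain_add, Finsupp.sub_add_single_one_cancel hi]
  rw [Finsupp.mapDomain_add, Finsupp.mapDomain_single, ← h, add_tsub_cancel_right]

/-- **M-convexity is transported along an injective relabeling of the coordinates.**
[cite: BrandenHuh2019, §2.2 Thm. 2.10 (the case of a permutation / `0/1` matrix `A`)] -/
theorem IsMConvex.image_mapDomain {J : Set (σ →₀ ℕ)} (hJ : IsMConvex J) {ι : σ → τ} (hι : Function.Injective ι) :
    IsMConvex (Finsupp.mapDomain ι '' J) := by
  classical
  rintro _ _ ⟨α, hα, rfl⟩ ⟨β, hβ, rfl⟩ i' hi'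
  -- `i'` is in the range of `ι`
  obtain ⟨i, rfl⟩ : i' ∈ Set.range ι := by
    by_contra h
    rw [Finsupp.mapDomain_notin_range _ _ h, Finsupp.mapDomain_notin_range _ _ h] at hi'
    exact lt_irrefl _ hi'
  rw [Finsupp.mapDomain_apply hι, Finsupp.mapDomain_apply hι] at hi'
  obtain ⟨j, hj, hmem⟩ := hJ hα hβ i hi'
  refine ⟨ι j, by rwa [Finsupp.mapDomain_apply hι, Finsupp.mapDomain_apply hι], ?_⟩
  rw [← mapDomain_sub_single_add_single ι (by omega) j]
  exact ⟨_, hmem, rfl⟩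

end MConvexOps

/-! ## §2 Signature plumbing: the zero form; pull-backs -/

section Signature

variable [Fintype σ] [DecidableEq σ] [Fintype τ] [DecidableEq τ]

omit [Fintype τ] [DecidableEq τ] in
/-- The zero quadratic form has no positive eigenvalue: `sigPos 0 = 0` (Sylvester: the whole space is non-positive).
[folklore] -/
private theorem sigPos_toBilin'_zero : sigPos (Matrix.toBilin' (0 : Matrix σ σ ℝ)).toQuadraticMap = 0 := by
  have h := QuadraticForm.sigPos_add_finrank_le_of_nonpos (Q := (Matrix.toBilin' (0 : Matrix σ σ ℝ)).toQuadraticMap)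
    (V := ⊤) fun x _ ↦ by simp
  rw [finrank_top] at h
  omega

/-- **Pull-back step**: if `M'_{ab} x_a y_b` summed is `Σ_{ij} (φ x)_i M_{ij} (φ y)_j` for a linear `φ`, then
`sigPos M' ≤ sigPos M` (tree: `LinearMap.BilinForm.sigPos_le_sigPos_of_comp`). [folklore] -/
private theorem sigPos_toBilin'_le_of_eq (M' : Matrix τ τ ℝ) (M : Matrix σ σ ℝ) (Lmap : (τ → ℝ) →ₗ[ℝ] (σ → ℝ))
    (h : ∀ x y, Matrix.toBilin' M (Lmap x) (Lmap y) = Matrix.toBilin' M' x y) :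
    sigPos (Matrix.toBilin' M').toQuadraticMap ≤ sigPos (Matrix.toBilin' M).toQuadraticMap :=
  LinearMap.BilinForm.sigPos_le_sigPos_of_comp _ _ Lmap h

end Signature

/-! ## §3 Dilations: `f(c_1 w_1, …, c_n w_n)` for `c ≥ 0` -/

section DiagScale

variable [Fintype σ]

/-- **The dilation `f(c_1 w_1, …, c_n w_n)`** of `f` by a vector `c` (Brändén–Huh's "(II) the dilation `f(w_1, …, θ w_n)`",
all coordinates at once), defined by its coefficients `coeff_α = c^α · coeff_α(f)`, `c^α = Π_i c_i^{α_i}` (`eval_diagScale`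
identifies it with the substitution). [cite: BrandenHuh2019, §2.2 proof of Thm. 2.10 (case (II))] -/
def diagScale (c : σ → ℝ) (f : MvPolynomial σ ℝ) : MvPolynomial σ ℝ :=
  ∑ α ∈ f.support, monomial α ((∏ i, c i ^ α i) * coeff α f)

/-- `diagScale c f` unfolded. [cite: BrandenHuh2019, §2.2 proof of Thm. 2.10 (case (II))] -/
theorem diagScale_def (c : σ → ℝ) (f : MvPolynomial σ ℝ) :
    diagScale c f = ∑ α ∈ f.support, monomial α ((∏ i, c i ^ α i) * coeff α f) := rfl

variable [DecidableEq σ]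

/-- **`coeff_α f(c·w) = c^α coeff_α f`.** [cite: BrandenHuh2019, §2.2 proof of Thm. 2.10 (case (II), "trivial to verify")] -/
theorem coeff_diagScale (c : σ → ℝ) (f : MvPolynomial σ ℝ) (α : σ →₀ ℕ) :
    coeff α (diagScale c f) = (∏ i, c i ^ α i) * coeff α f := by
  rw [diagScale, coeff_sum]
  simp_rw [coeff_monomial]
  by_cases hα : α ∈ f.support
  · rw [Finset.sum_eq_single_of_mem α hα fun β _ hβ ↦ if_neg hβ, if_pos rfl]
  · rw [Finset.sum_eq_zero fun β hβ ↦ if_neg (fun h : β = α ↦ hα (h ▸ hβ)), MvPolynomial.notMem_support_iff.1 hα, mul_zero]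

omit [DecidableEq σ] in
/-- **`f(c·w)(w) = f(c_1 w_1, …, c_n w_n)`**: the dilation is the substitution `w_i ↦ c_i w_i`.
[cite: BrandenHuh2019, §2.2 Thm. 2.10 ("`f(Av)`" with `A = diag(c)`)] -/
theorem eval_diagScale (c : σ → ℝ) (f : MvPolynomial σ ℝ) (w : σ → ℝ) :
    eval w (diagScale c f) = eval (fun i ↦ c i * w i) f := by
  classical
  rw [diagScale, map_sum]
  conv_rhs => rw [f.as_sum, map_sum]
  refine Finset.sum_congr rfl fun α _ ↦ ?_
  rw [eval_monomial, eval_monomial, mul_pow_prodstep c w α]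
  ring
  where
  /-- `Π_i (c_i w_i)^{α_i} = c^α · w^α`. [folklore] -/
  mul_pow_prodstep (c w : σ → ℝ) (α : σ →₀ ℕ) :
      (α.prod fun i k ↦ (c i * w i) ^ k) = (∏ i, c i ^ α i) * α.prod fun i k ↦ w i ^ k := by
    classical
    rw [Finsupp.prod_fintype _ _ (fun _ ↦ pow_zero _), Finsupp.prod_fintype _ _ (fun _ ↦ pow_zero _),
      ← Finset.prod_mul_distrib]
    exact Finset.prod_congr rfl fun i _ ↦ mul_pow _ _ _

/-- `c_α(f(c·w)) = c^α c_α(f)` for the normalized coefficients. [cite: BrandenHuh2019, §2.2 proof of Thm. 2.10 (case (II))] -/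
theorem normCoeff_diagScale (c : σ → ℝ) (f : MvPolynomial σ ℝ) (α : σ →₀ ℕ) :
    normCoeff α (diagScale c f) = (∏ i, c i ^ α i) * normCoeff α f := by
  rw [normCoeff, normCoeff, coeff_diagScale, mul_left_comm]

omit [DecidableEq σ] in
/-- Dilation preserves homogeneity. [cite: BrandenHuh2019, §2.2 Thm. 2.10] -/
theorem isHomogeneous_diagScale (c : σ → ℝ) {f : MvPolynomial σ ℝ} {d : ℕ} (hf : f.IsHomogeneous d) :
    (diagScale c f).IsHomogeneous d := by
  classical
  intro α hα
  rw [coeff_diagScale] at hα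
  have h : coeff α f ≠ 0 := fun h0 ↦ hα (by rw [h0, mul_zero])
  exact hf h

omit [DecidableEq σ] in
/-- `c^α ≥ 0` for `c ≥ 0`. [folklore] -/
private theorem prod_pow_nonneg {c : σ → ℝ} (hc : ∀ i, 0 ≤ c i) (α : σ →₀ ℕ) : 0 ≤ ∏ i, c i ^ α i :=
  Finset.prod_nonneg fun i _ ↦ pow_nonneg (hc i) _

/-- **The support of `f(c·w)`** for `c ≥ 0`: the coordinate face `{α ∈ supp f : α_i = 0 whenever c_i = 0}`.
[cite: BrandenHuh2019, §2.2 proof of Thm. 2.10 (case (II): "`f(w_1, …, w_{n-1}, 0) ∈ M^d_n`")] -/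
theorem support_diagScale (c : σ → ℝ) (f : MvPolynomial σ ℝ) :
    {α : σ →₀ ℕ | coeff α (diagScale c f) ≠ 0} =
      {α | α ∈ {β : σ →₀ ℕ | coeff β f ≠ 0} ∧ ∀ i ∈ {i | c i = 0}, α i = 0} := by
  ext α
  simp only [Set.mem_setOf_eq, coeff_diagScale, mul_ne_zero_iff, Finset.prod_ne_zero_iff, Finset.mem_univ, true_imp_iff]
  constructor
  · rintro ⟨h1, h2⟩
    refine ⟨h2, fun i hi ↦ ?_⟩
    by_contra hαi
    exact h1 i (by rw [hi, zero_pow hαi])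
  · rintro ⟨h2, h1⟩
    refine ⟨fun i ↦ ?_, h2⟩
    by_cases hci : c i = 0
    · rw [h1 i hci, pow_zero]; exact one_ne_zero
    · exact pow_ne_zero _ hci

/-- **Brändén–Huh Theorem 2.10, case (II) (dilations): `f ∈ L^d_n`, `c ≥ 0 ⟹ f(c_1 w_1, …, c_n w_n) ∈ L^d_n`** — in
particular setting any set of variables to zero keeps a polynomial Lorentzian. By Theorem 2.25's criterion: the support
becomes a coordinate face (M-convex), and for `α ∈ Δ^{d-2}` the matrix `(c_{α+e_a+e_b}(f(c·w)))_{ab} =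
(c^α c_a c_b · c_{α+e_a+e_b}(f))_{ab}` is the pull-back of `(c_{α+e_a+e_b}(f))_{ab}` along `x ↦ √(c^α) (c_a x_a)_a`, so its
positive index is still `≤ 1`. [cite: BrandenHuh2019, §2.2 Thm. 2.10 and its proof, case (II)] -/
theorem diagScale_mem_lorentzian {c : σ → ℝ} (hc : ∀ i, 0 ≤ c i) :
    ∀ {d : ℕ} {f : MvPolynomial σ ℝ}, f ∈ lorentzian σ d → diagScale c f ∈ lorentzian σ d
  | 0, f, hf => mem_lorentzian_zero.2 ⟨isHomogeneous_diagScale c hf.1,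
      fun α ↦ by rw [coeff_diagScale]; exact mul_nonneg (prod_pow_nonneg hc α) (hf.2 α)⟩
  | 1, f, hf => mem_lorentzian_one.2 ⟨isHomogeneous_diagScale c hf.1,
      fun α ↦ by rw [coeff_diagScale]; exact mul_nonneg (prod_pow_nonneg hc α) (hf.2 α)⟩
  | m + 2, f, hf => by
    obtain ⟨⟨hhom, hnn, hM⟩, hsig⟩ := mem_lorentzian_iff_forall_sigPos_normCoeff.1 hf
    refine mem_lorentzian_iff_forall_sigPos_normCoeff.2 ⟨⟨isHomogeneous_diagScale c hhom,
      fun α ↦ by rw [coeff_diagScale]; exact mul_nonneg (prod_pow_nonneg hc α) (hnn α), ?_⟩, fun α hα ↦ ?_⟩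
    · rw [support_diagScale c f]; exact hM.sep_apply_eq_zero _
    · -- pull back along `x ↦ √(c^α) · (c_a x_a)_a`
      set lam : ℝ := Real.sqrt (∏ i, c i ^ α i) with hlam
      have hlam2 : lam * lam = ∏ i, c i ^ α i := Real.mul_self_sqrt (prod_pow_nonneg hc α)
      set Lmap : (σ → ℝ) →ₗ[ℝ] (σ → ℝ) :=
        { toFun := fun x a ↦ lam * (c a * x a)
          map_add' := fun x y ↦ by ext a; simp only [Pi.add_apply]; ring
          map_smul' := fun r x ↦ by ext a; simp only [Pi.smul_apply, smul_eq_mul, RingHom.id_apply]; ring } with hL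
      refine (sigPos_toBilin'_le_of_eq _ (Matrix.of fun a b ↦ normCoeff (α + Finsupp.single a 1 + Finsupp.single b 1) f)
        Lmap fun x y ↦ ?_).trans (hsig α hα)
      rw [Matrix.toBilin'_apply, Matrix.toBilin'_apply]
      refine Finset.sum_congr rfl fun a _ ↦ Finset.sum_congr rfl fun b _ ↦ ?_
      have hsingle : ∀ k : σ, ∏ i, c i ^ (Finsupp.single k 1 i) = c k := fun k ↦ by
        rw [Finset.prod_eq_single_of_mem k (Finset.mem_univ k)
          (fun i _ hi ↦ by rw [Finsupp.single_apply, if_neg (Ne.symm hi), pow_zero]), Finsupp.single_eq_same, pow_one]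
      have hprod : (∏ i, c i ^ (α i + Finsupp.single a 1 i + Finsupp.single b 1 i)) = (∏ i, c i ^ α i) * c a * c b := by
        simp_rw [pow_add, Finset.prod_mul_distrib]
        rw [hsingle a, hsingle b]
      simp only [Matrix.of_apply, hL, LinearMap.coe_mk, AddHom.coe_mk, normCoeff_diagScale, Finsupp.add_apply]
      rw [hprod, ← hlam2]
      ring

end DiagScale

/-! ## §4 Injective renaming: permutations of the variables, dummy variables -/

section Rename

variable [Fintype σ] [Fintype τ]

/-- `(mapDomain ι α)! = α!`: relabeling does not change `Π_i α_i!` (the new coordinates are `0`, `0! = 1`).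
[cite: BrandenHuh2019, §2.2 (p. 11, `α!`)] -/
theorem factorialProd_mapDomain {ι : σ → τ} (hι : Function.Injective ι) (α : σ →₀ ℕ) :
    factorialProd (Finsupp.mapDomain ι α) = factorialProd α := by
  classical
  rw [factorialProd, factorialProd, ← Finset.prod_subset (Finset.subset_univ (Finset.univ.image ι)),
    Finset.prod_image fun i _ j _ h ↦ hι h]
  · exact Finset.prod_congr rfl fun i _ ↦ by rw [Finsupp.mapDomain_apply hι]
  · intro a _ ha
    rw [Finsupp.mapDomain_notin_range _ _ (fun ⟨i, hi⟩ ↦ ha (Finset.mem_image.2 ⟨i, Finset.mem_univ i, hi⟩)),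
      Nat.factorial_zero, Nat.cast_one]

/-- `c_{ι_* α}(rename ι f) = c_α(f)` for injective `ι`. [cite: BrandenHuh2019, §2.2 Thm. 2.10 (permutation / `0/1` matrix `A`)] -/
theorem normCoeff_rename_mapDomain {ι : σ → τ} (hι : Function.Injective ι) (f : MvPolynomial σ ℝ) (α : σ →₀ ℕ) :
    normCoeff (Finsupp.mapDomain ι α) (rename ι f) = normCoeff α f := by
  rw [normCoeff, normCoeff, factorialProd_mapDomain hι, coeff_rename_mapDomain ι hι]

omit [Fintype σ] [Fintype τ] in
/-- Exponents outside the image of `ι_*` do not occur in `rename ι f`. [cite: BrandenHuh2019, §2.2 Thm. 2.10] -/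
theorem coeff_rename_eq_zero_of_not_mem_range {ι : σ → τ} (f : MvPolynomial σ ℝ) {β : τ →₀ ℕ}
    (hβ : β ∉ Set.range (Finsupp.mapDomain ι : (σ →₀ ℕ) → τ →₀ ℕ)) : coeff β (rename ι f) = 0 :=
  coeff_rename_eq_zero ι f β fun α hα ↦ absurd ⟨α, hα⟩ hβ

omit [Fintype σ] [Fintype τ] in
/-- An exponent on `τ` supported in the range of an injective `ι` comes from `σ`. [folklore] -/
private theorem exists_mapDomain_eq {ι : σ → τ} (hι : Function.Injective ι) {β : τ →₀ ℕ}
    (hβ : ∀ a, β a ≠ 0 → a ∈ Set.range ι) : ∃ α : σ →₀ ℕ, Finsupp.mapDomain ι α = β := by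
  classical
  refine ⟨Finsupp.comapDomain ι β hι.injOn, ?_⟩
  ext a
  by_cases ha : a ∈ Set.range ι
  · obtain ⟨i, rfl⟩ := ha
    rw [Finsupp.mapDomain_apply hι, Finsupp.comapDomain_apply]
  · rw [Finsupp.mapDomain_notin_range _ _ ha]
    by_contra h
    exact ha (hβ a (Ne.symm h))

omit [Fintype σ] [Fintype τ] in
/-- The support of `rename ι f` is the image of the support of `f`. [cite: BrandenHuh2019, §2.2 Thm. 2.10] -/
theorem support_rename_of_injective {ι : σ → τ} (hι : Function.Injective ι) (f : MvPolynomial σ ℝ) :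
    {β : τ →₀ ℕ | coeff β (rename ι f) ≠ 0} = Finsupp.mapDomain ι '' {α | coeff α f ≠ 0} := by
  ext β
  constructor
  · intro hβ
    have hr : β ∈ Set.range (Finsupp.mapDomain ι : (σ →₀ ℕ) → τ →₀ ℕ) := by
      by_contra h
      exact hβ (coeff_rename_eq_zero_of_not_mem_range f h)
    obtain ⟨α, rfl⟩ := hr
    rw [Set.mem_setOf_eq, coeff_rename_mapDomain ι hι] at hβ
    exact ⟨α, hβ, rfl⟩
  · rintro ⟨α, hα, rfl⟩
    rw [Set.mem_setOf_eq, coeff_rename_mapDomain ι hι]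
    exact hα

omit [Fintype σ] [Fintype τ] in
/-- Renaming along an injective map keeps coefficients nonnegative. [cite: BrandenHuh2019, §2.2 Thm. 2.10] -/
theorem coeff_rename_nonneg {ι : σ → τ} (hι : Function.Injective ι) {f : MvPolynomial σ ℝ} (hnn : ∀ α, 0 ≤ coeff α f)
    (β : τ →₀ ℕ) : 0 ≤ coeff β (rename ι f) := by
  classical
  by_cases hβ : β ∈ Set.range (Finsupp.mapDomain ι : (σ →₀ ℕ) → τ →₀ ℕ)
  · obtain ⟨α, rfl⟩ := hβ
    rw [coeff_rename_mapDomain ι hι]; exact hnn α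
  · rw [coeff_rename_eq_zero_of_not_mem_range f hβ]

variable [DecidableEq σ] [DecidableEq τ]

/-- **Brändén–Huh Theorem 2.10 for an injective relabeling `ι`** (the `0/1` matrix of `ι`: permutations of the variables and
adjoining variables on which `f` does not depend): `f ∈ L^d_σ ⟹ rename ι f ∈ L^d_τ`. By Theorem 2.25's criterion: the
support is the relabeled support (M-convex), and for `β ∈ Δ^{d-2}_τ` the matrix `(c_{β+e_a+e_b}(rename ι f))_{ab}` is
either `0` (`β ∉ im ι_*`) or the matrix `(c_{α+e_i+e_j}(f))_{ij}` padded with zero rows and columns — the pull-back of the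
latter along `x ↦ x ∘ ι`. [cite: BrandenHuh2019, §2.2 Thm. 2.10] -/
theorem rename_mem_lorentzian {ι : σ → τ} (hι : Function.Injective ι) :
    ∀ {d : ℕ} {f : MvPolynomial σ ℝ}, f ∈ lorentzian σ d → rename ι f ∈ lorentzian τ d
  | 0, f, hf => mem_lorentzian_zero.2 ⟨hf.1.rename_isHomogeneous, coeff_rename_nonneg hι hf.2⟩
  | 1, f, hf => mem_lorentzian_one.2 ⟨hf.1.rename_isHomogeneous, coeff_rename_nonneg hι hf.2⟩
  | m + 2, f, hf => by
    obtain ⟨⟨hhom, hnn, hM⟩, hsig⟩ := mem_lorentzian_iff_forall_sigPos_normCoeff.1 hf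
    refine mem_lorentzian_iff_forall_sigPos_normCoeff.2
      ⟨⟨hhom.rename_isHomogeneous, coeff_rename_nonneg hι hnn, ?_⟩, fun β hβ ↦ ?_⟩
    · rw [support_rename_of_injective hι]; exact hM.image_mapDomain hι
    · by_cases hr : ∀ a, β a ≠ 0 → a ∈ Set.range ι
      · -- `β = ι_* α`: pull back along `x ↦ x ∘ ι`
        obtain ⟨α, rfl⟩ := exists_mapDomain_eq hι hr
        rw [Finsupp.degree_mapDomain] at hβ
        set Lmap : (τ → ℝ) →ₗ[ℝ] (σ → ℝ) :=
          { toFun := fun x i ↦ x (ι i)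
            map_add' := fun x y ↦ rfl
            map_smul' := fun r x ↦ rfl } with hL
        refine (sigPos_toBilin'_le_of_eq _ (Matrix.of fun i j ↦ normCoeff (α + Finsupp.single i 1 + Finsupp.single j 1) f)
          Lmap fun x y ↦ ?_).trans (hsig α hβ)
        rw [Matrix.toBilin'_apply, Matrix.toBilin'_apply]
        -- the `τ`-sum is supported on `im ι × im ι`
        symm
        rw [← Finset.sum_subset (Finset.subset_univ (Finset.univ.image ι)) fun a _ ha ↦ ?_]
        · rw [Finset.sum_image fun i _ j _ h ↦ hι h]
          refine Finset.sum_congr rfl fun i _ ↦ ?_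
          rw [← Finset.sum_subset (Finset.subset_univ (Finset.univ.image ι)) fun b _ hb ↦ ?_]
          · rw [Finset.sum_image fun i _ j _ h ↦ hι h]
            refine Finset.sum_congr rfl fun j _ ↦ ?_
            simp only [Matrix.of_apply, hL, LinearMap.coe_mk, AddHom.coe_mk]
            rw [← Finsupp.mapDomain_single (f := ι) (a := i), ← Finsupp.mapDomain_single (f := ι) (a := j),
              ← Finsupp.mapDomain_add, ← Finsupp.mapDomain_add, normCoeff_rename_mapDomain hι]
          · rw [Matrix.of_apply, normCoeff, coeff_rename_eq_zero_of_not_mem_range f, mul_zero, mul_zero, zero_mul]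
            rintro ⟨γ, hγ⟩
            have h := congr_arg (fun δ ↦ δ b) hγ
            simp only [Finsupp.add_apply, Finsupp.single_eq_same] at h
            rw [Finsupp.mapDomain_notin_range _ _ (fun ⟨i', hi'⟩ ↦ hb (Finset.mem_image.2 ⟨i', Finset.mem_univ _, hi'⟩))]
              at h
            have h2 : (Finsupp.single (ι i) 1 : τ →₀ ℕ) b = 0 :=
              Finsupp.single_eq_of_ne fun h' ↦ hb (Finset.mem_image.2 ⟨i, Finset.mem_univ _, h'.symm⟩)
            rw [h2] at h
            omega
        · rw [Finset.sum_eq_zero fun b _ ↦ ?_]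
          rw [Matrix.of_apply, normCoeff, coeff_rename_eq_zero_of_not_mem_range f, mul_zero, mul_zero, zero_mul]
          rintro ⟨γ, hγ⟩
          have h := congr_arg (fun δ ↦ δ a) hγ
          simp only [Finsupp.add_apply] at h
          rw [Finsupp.mapDomain_notin_range _ _ (fun ⟨i', hi'⟩ ↦ ha (Finset.mem_image.2 ⟨i', Finset.mem_univ _, hi'⟩)),
            Finsupp.mapDomain_notin_range _ _ (fun ⟨i', hi'⟩ ↦ ha (Finset.mem_image.2 ⟨i', Finset.mem_univ _, hi'⟩)),
            Finsupp.single_eq_same] at h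
          have h2 : (Finsupp.single b 1 : τ →₀ ℕ) a = 0 ∨ (Finsupp.single b 1 : τ →₀ ℕ) a = 1 := by
            rw [Finsupp.single_apply]; split_ifs <;> simp
          omega
      · -- `β ∉ im ι_*`: every `c_{β+e_a+e_b}` vanishes
        push Not at hr
        obtain ⟨a₀, ha₀, hna₀⟩ := hr
        have hzero : (Matrix.of fun a b ↦ normCoeff (β + Finsupp.single a 1 + Finsupp.single b 1) (rename ι f)) =
            (0 : Matrix τ τ ℝ) := by
          ext a b
          rw [Matrix.of_apply, Matrix.zero_apply, normCoeff, coeff_rename_eq_zero_of_not_mem_range f, mul_zero]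
          rintro ⟨γ, hγ⟩
          have h := congr_arg (fun δ ↦ δ a₀) hγ
          simp only [Finsupp.add_apply] at h
          rw [Finsupp.mapDomain_notin_range _ _ hna₀] at h
          omega
        rw [hzero, sigPos_toBilin'_zero]
        exact zero_le_one

end Rename

end Literature.Combinatorics.LorentzianPolynomials

end
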